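import Summits.QuantumFields.BalabanUV.Beta.RowD1SymmetriesDischarged
import Summits.QuantumFields.BalabanUV.Beta.D1BFx.FirstStepPinned

/-!
# `BalabanUV.Beta.RowD1Telescoping` — binder row D1: **THE TELESCOPING BINDER `D1Tel` FOR THE LITERAL OF RECORD
# `JsRowD1Pin hLc N` AND BF-x's ONE-SHOT JETS `JcPin hLc N`, SKELETON-FIRST — every per-step datum of the two sockets
# (`HessianTelescopingKKT` LAYER 1, `StepDriftWitness` §7–§9) DISCHARGED; what remains is ONE closed clause over the literal**
# (β sub-cell, BINDER-OWNERS row D1 OWNER, lineage an2 gen 22)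

HONEST FRAMING (cell charter, verbatim): «discharging BetaPertH makes Balaban's UV stability UNCONDITIONAL — a real
constructive-QFT result; it is NOT the continuum limit and NOT the Clay problem.»
HONEST DEPENDENCY: continuum YM on T⁴ ⇐ BetaPertH ∧ nine spine estimates (0/9 proved); BetaPertH ⇐ (D1) ∧ (D4) ∧ CAP+tail;
G-an2-4 gates asym, D1 and NE2/3/4.

ABSOLUTE RULE (cell, verbatim): «No internally-minted statement may enter as a cited fact. Every hypothesis is either kernel-proved in this
package or a verbatim quotation of a PUBLISHED theorem with page reference. The manuscript(s) under audit are NOT citable for their own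
disputed steps — they are the thing under adjudication; programme-internal (2001/route/tribunal) claims are never citable.»
NOTHING below is cited: no `[cite: …]`, no `def … : Prop`, no new object.  Every declaration is [folklore]: a composition BY NAME of landed
modules — an4's `HessianTelescopingKKT` (LAYER 1 of node P6: `StepRecursion`, `StepRecursionUpTo`, `wStep`, `d1Tel_of_stepRecursion_wStep`, …),
the β-lead's `StepDriftWitness` §7–§9 (`D1Sum`, `SD`, `SDInvisible`, `d1Sum_iff_sdInvisible'`, `d1Drift_of_sdInvisible_D1Rep`,
`secondMoment_step_sd`) and `ScalewiseVectorSeam.scalewiseData_of_printed_flip`, an2/an4's `OneStepKernelFamily` (`hdec_TbalOf`, `D1Tel`, `D1Rep`,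
`D1Drift`), the row's capstone `RowD1SymmetriesDischarged.symmetries_JsRowD1Pin` (hW ∧ hR for the literal of record are THEOREMS, binders 2∕4)
and road BF-x's `D1BFx.FirstStepPinned` (`JcPin`, `TshotOf_JcPin_eq_TbalOf_zero`).

WHY (row D1 owner, gen 22; successor instruction of gen 21, `HOME/HANDOFF.md` «beta-an2-g21 — FINAL STATE», (1)–(2)).  After the capstone the
row END reads `D1Drift Lc (JsRowD1Pin hLc N) Nc μ ν ⟸ D1Tel Lc (JsRowD1Pin hLc N) Jc ∧ D1Rep Lc Jc Nc μ ν a SL k`.  With BF-x's one-shot jets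
`JcPin hLc N m := JsRowD1Pin (Lc := Lc^m) hLc.pow N 0` (the one-shot system at blocking `Lc^m` IS the first step of the literal of record at block
`Lc^m`), the two tree sockets for the telescoping binder ask, besides their one content clause, for PER-STEP DATA: (T0)/(T1)/hTA of the step
kernels `TbalOf Lc (JsRowD1Pin hLc N) j`, (T0)/(T1) of the one-shot kernels `TshotOf Lc (JcPin hLc N) m`, the base identity
`TshotOf Lc (JcPin hLc N) 1 = TbalOf Lc (JsRowD1Pin hLc N) 0`, and (for a general transport weight) reproduction data of the weight.  THIS FILE
DISCHARGES ALL OF THEM FOR THE LITERAL OF RECORD: the Ward data of BOTH families follow from the capstone's hW ∧ hR (at block `Lc` for the step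
family, at block `Lc^m`, `j = 0`, for the one-shot family — `Odd (Lc^m)` from `Odd Lc`) through `scalewiseData_of_printed_flip` with `hdec_TbalOf`;
the base identity is `TshotOf_JcPin_eq_TbalOf_zero` at `m = 1` transported along `Lc^1 = Lc` (`subst`); the weight data are an4's for `wStep`.

WHAT (all [folklore]; §-numbers below):
§1 DATA OF THE LITERAL, DISCHARGED: `stepData_JsRowD1Pin` (hTA ∧ (T0) ∧ (T1) of `TbalOf Lc (JsRowD1Pin hLc N)`, from `Odd Lc`, `2 ≤ N` only),
   `TbalOf_JsRowD1Pin_zero_congr` (block-size transport), `hbase_JcPin` (`TshotOf Lc (JcPin hLc N) 1 = TbalOf Lc (JsRowD1Pin hLc N) 0`),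
   `shotData_JcPin` ((T0) ∧ (T1) of `TshotOf Lc (JcPin hLc N) m`, every `m`).
§2 `D1Tel` LEVEL (all `4⁴` tensor components): `d1Tel_JsRowD1Pin_of_stepRecursion` (general weight `w`: reproduction data of `w` + (R1)),
   **`d1Tel_JsRowD1Pin_of_stepRecursion_wStep`** (`D1Tel ⟸ StepRecursion Lc (TbalOf …) (TshotOf …) (wStep Lc)` — ONE hypothesis),
   `d1Tel_JsRowD1Pin_of_stepRecursionUpTo_wStep` ((R1) modulo a remainder `R` invisible at the second-moment-tensor level),
   `d1Tel_JsRowD1Pin_of_m2Step` (the transport-free second-moment-tensor step identity), `d1Tel_JsRowD1Pin_iff_m2Step`.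
§3 READ-OUT LEVEL (the level the wall consumes, RULING (R27)/(R28-1)): `d1Sum_JsRowD1Pin_of_d1Tel`; **`secondMoment_step_JcPin`** — UNCONDITIONALLY,
   for every `j ≥ 1` and every channel, `secondMoment (TshotOf Lc (JcPin hLc N) (j+1)) μ ν = secondMoment (TshotOf Lc (JcPin hLc N) j) μ ν +
   secondMoment (TbalOf Lc (JsRowD1Pin hLc N) j) μ ν + secondMoment (SD Lc (JsRowD1Pin hLc N) (JcPin hLc N) j) μ ν`;
   **`d1Sum_JsRowD1Pin_iff_sdInvisible`**: `D1Sum Lc (JsRowD1Pin hLc N) (JcPin hLc N) μ ν ↔ SDInvisible Lc (JsRowD1Pin hLc N) (JcPin hLc N) μ ν` from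
   `Odd Lc`, `2 ≤ N` ONLY — for the literal of record the read-out-level telescoping binder IS the single closed clause
   (SDF) `∀ j ≥ 1, secondMoment (SD Lc (JsRowD1Pin hLc N) (JcPin hLc N) j) μ ν = 0`; `sdInvisible_JsRowD1Pin_of_stepRecursion_wStep` ((R1) ⟹ (SDF)).
§4 THE ROW END RE-CUT: **`d1Drift_JsRowD1Pin_of_sdInvisible_D1Rep`** (`D1Drift Lc (JsRowD1Pin hLc N) Nc μ ν ⟸ SDInvisible … μ ν ∧ D1Rep …` + the
   route's printed B5 facts BY NAME, window data, `μ ≠ ν`, `Nc ≠ 0`, `2 ≤ Lc`, `2 ≤ N` — NO Ward∕reflection binder, NO `D1Tel`, NO transport family),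
   `d1Drift_JsRowD1Pin_of_d1Sum_D1Rep`, `d1Drift_JsRowD1Pin_of_stepRecursion_D1Rep`.
WHAT REMAINS OF ROW D1 AFTER THIS FILE, EXACTLY: (SDF) for the literal — the `(μ, ν)` second moment of the full step defect
`SD Lc (JsRowD1Pin hLc N) (JcPin hLc N) j` = (first step of the literal at block `Lc^(j+1)`) − (first step at block `Lc^j` transported through an4's
canonical response `wStep Lc j` on both legs, bond units) − (step `j` of the literal at block `Lc`) vanishes for every `j ≥ 1` (the semigroup law
of the averaging operations at one loop, read out; LAYER 2 of node P6 + P6c, owners of record an5 `ResolventComposition(StepB)` ∕ road FP ∕ G-an2-4 —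
NOT proved here, NOT claimed) — and `D1Rep` (EXIT-A ⇐ G-an2-4).  Binders 2∕4; NOT D1, NOT `BetaPertH`, NOT continuum, NOT Clay.
Provenance: β sub-cell, unit beta-an2 gen 22, 2026-08-20 (v1); no existing file touched.
-/

open Finset
open scoped BigOperators
open Literature.MathematicalPhysics.QuantumFieldTheory
open Literature.MathematicalPhysics.QuantumFieldTheory.Balaban1983to89
open Literature.MathematicalPhysics.QuantumFieldTheory.Balaban1983to89.Beta
open PolarizationSign (WardTransversal AxisReflectionCovariant)
open DecimatedMomentSummable (AbsMoment₂ ConstReproSum LinReproSum)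
open DressedMomentNormalisation (EKer m2Tensor dressedEntry)
open OneStepResolventKernel (JetData)
open OneStepKernelFamily (TbalOf TshotOf flipK D1Tel D1Rep D1Drift hdec_TbalOf hTA_TbalOf)
open HessianTelescopingKKT (StepRecursion StepRecursionUpTo AdmissibleTransport wStep d1Tel_of_stepRecursion_of_stepWard
  d1Tel_of_stepRecursion_wStep d1Tel_of_stepRecursionUpTo_wStep d1Tel_of_m2Step d1Tel_iff_m2Step stepRecursion_iff_stepDefect_eq_zero)
open StepDriftWitness (D1Sum SD SDInvisible d1Sum_of_d1Tel d1Sum_iff_sdInvisible' secondMoment_step_sd absMoment₂_sd sd_eq_stepDefect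
  d1Drift_of_sdInvisible_D1Rep d1Drift_of_d1Sum_D1Rep)
open ScalewiseVectorSeam (scalewiseData_of_printed_flip)
open B12Beta (secondMoment)
open Literature.MathematicalPhysics.QuantumFieldTheory.Balaban1983to89.Beta.VectorTailsLoc (fam kfam)
open Literature.MathematicalPhysics.QuantumFieldTheory.Balaban1983to89.Beta.VectorLegVolumeAdapter (MvE)
open Summit.QuantumFields.BalabanUV.Beta.RowD1JointEnd (JsRowD1Pin)
open Summit.QuantumFields.BalabanUV.Beta.RowD1SymmetriesDischarged (symmetries_JsRowD1Pin)
open Summit.QuantumFields.BalabanUV.Beta.D1BFx.FirstStepPinned (JcPin TshotOf_JcPin_eq_TbalOf_zero)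

namespace Summit.QuantumFields.BalabanUV.Beta.RowD1Telescoping

noncomputable section

variable {Lc : ℕ} [NeZero Lc]

/-! ## §1 The per-step data of the literal of record, DISCHARGED -/

/-- [folklore] **hTA ∧ (T0) ∧ (T1) FOR THE STEP KERNELS OF THE LITERAL OF RECORD** (`Odd Lc`, `2 ≤ N` only): absolutely summable second
moments, vanishing zeroth moments and vanishing first moments of every channel of `TbalOf Lc (JsRowD1Pin hLc N) j`, every `j` — the
β-lead's `scalewiseData_of_printed_flip` at the uniform decay `hdec_TbalOf` and the capstone's hW ∧ hR `symmetries_JsRowD1Pin hLc hN`. -/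
theorem stepData_JsRowD1Pin (hLc : Odd Lc) {N : ℕ} (hN : 2 ≤ N) :
    (∀ j (c e : Fin 4), AbsMoment₂ (TbalOf Lc (JsRowD1Pin hLc N) j c e)) ∧
      (∀ j (c e : Fin 4), HasSum (TbalOf Lc (JsRowD1Pin hLc N) j c e) 0) ∧
        (∀ j (c e ρ : Fin 4), HasSum (fun t : Fin 4 → ℤ => t ρ • TbalOf Lc (JsRowD1Pin hLc N) j c e t) 0) :=
  scalewiseData_of_printed_flip (hdec_TbalOf (JsRowD1Pin hLc N)) (symmetries_JsRowD1Pin hLc hN).1 (symmetries_JsRowD1Pin hLc hN).2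

/-- [folklore] (T0) of the step kernels of the literal of record. -/
theorem stepT0_JsRowD1Pin (hLc : Odd Lc) {N : ℕ} (hN : 2 ≤ N) :
    ∀ j (c e : Fin 4), HasSum (TbalOf Lc (JsRowD1Pin hLc N) j c e) 0 :=
  (stepData_JsRowD1Pin hLc hN).2.1

/-- [folklore] (T1) of the step kernels of the literal of record. -/
theorem stepT1_JsRowD1Pin (hLc : Odd Lc) {N : ℕ} (hN : 2 ≤ N) :
    ∀ j (c e ρ : Fin 4), HasSum (fun t : Fin 4 → ℤ => t ρ • TbalOf Lc (JsRowD1Pin hLc N) j c e t) 0 :=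
  (stepData_JsRowD1Pin hLc hN).2.2

omit [NeZero Lc] in
/-- [folklore] **BLOCK-SIZE TRANSPORT**: the first step kernel of the literal of record depends on the block size only through its value
(`subst`; `Odd`-proof and `NeZero` instance are proof-irrelevant). -/
theorem TbalOf_JsRowD1Pin_zero_congr {n n' : ℕ} [NeZero n] [NeZero n'] (h : n = n') (hn : Odd n) (hn' : Odd n') (N : ℕ) :
    TbalOf n (JsRowD1Pin hn N) 0 = TbalOf n' (JsRowD1Pin hn' N) 0 := by
  subst h
  rfl

/-- [folklore] **THE BASE IDENTITY (R0) FOR THE LITERAL OF RECORD, DISCHARGED**: the one-shot kernel at blocking `Lc^1` IS the step-`0` kernel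
(`TshotOf_JcPin_eq_TbalOf_zero` at `m = 1`, transported along `Lc^1 = Lc`). -/
theorem hbase_JcPin (hLc : Odd Lc) (N : ℕ) : TshotOf Lc (JcPin hLc N) 1 = TbalOf Lc (JsRowD1Pin hLc N) 0 := by
  rw [TshotOf_JcPin_eq_TbalOf_zero]
  exact TbalOf_JsRowD1Pin_zero_congr (pow_one Lc) _ hLc N

/-- [folklore] **(T0) ∧ (T1) FOR THE ONE-SHOT KERNELS OF RECORD** `TshotOf Lc (JcPin hLc N) m` (every `m`; `Odd Lc`, `2 ≤ N` only): the one-shot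
kernel at blocking `Lc^m` is the first step of the literal at block `Lc^m` (`TshotOf_JcPin_eq_TbalOf_zero`), whose Ward data are §1's at block
`Lc^m` (`Odd (Lc^m)` from `Odd Lc`). -/
theorem shotData_JcPin (hLc : Odd Lc) {N : ℕ} (hN : 2 ≤ N) :
    (∀ m (c e : Fin 4), HasSum (TshotOf Lc (JcPin hLc N) m c e) 0) ∧
      (∀ m (c e ρ : Fin 4), HasSum (fun t : Fin 4 → ℤ => t ρ • TshotOf Lc (JcPin hLc N) m c e t) 0) := by
  refine ⟨fun m c e => ?_, fun m c e ρ => ?_⟩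
  · rw [TshotOf_JcPin_eq_TbalOf_zero]
    exact stepT0_JsRowD1Pin (Lc := Lc ^ m) hLc.pow hN 0 c e
  · have h := stepT1_JsRowD1Pin (Lc := Lc ^ m) hLc.pow hN 0 c e ρ
    refine h.congr_fun fun t => ?_
    rw [TshotOf_JcPin_eq_TbalOf_zero]

/-- [folklore] (T0) of the one-shot kernels of record, `m ≥ 1` form (the sockets' shape). -/
theorem shotT0_JcPin (hLc : Odd Lc) {N : ℕ} (hN : 2 ≤ N) :
    ∀ m, 1 ≤ m → ∀ c e : Fin 4, HasSum (TshotOf Lc (JcPin hLc N) m c e) 0 :=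
  fun m _ c e => (shotData_JcPin hLc hN).1 m c e

/-- [folklore] (T1) of the one-shot kernels of record, `m ≥ 1` form. -/
theorem shotT1_JcPin (hLc : Odd Lc) {N : ℕ} (hN : 2 ≤ N) :
    ∀ m, 1 ≤ m → ∀ c e ρ : Fin 4, HasSum (fun t : Fin 4 → ℤ => t ρ • TshotOf Lc (JcPin hLc N) m c e t) 0 :=
  fun m _ c e ρ => (shotData_JcPin hLc hN).2 m c e ρ

/-! ## §2 The `D1Tel` level (all `4⁴` second-moment-tensor components) -/

/-- [folklore] **`D1Tel` FOR THE LITERAL OF RECORD FROM THE ONE-STEP RECURSION THROUGH A GENERAL RESPONSE WEIGHT `w`**: reproduction data of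
`w j` (`j ≥ 1`: Kronecker `Lc`-coset mass `δ·Lc^{-5}`, affine reproduction, `AbsMoment₂`) and (R1)
`StepRecursion Lc (TbalOf Lc (JsRowD1Pin hLc N)) (TshotOf Lc (JcPin hLc N)) w` give `D1Tel`; (T0)/(T1) of the step kernels and the base identity are
§1's (an4's `d1Tel_of_stepRecursion_of_stepWard`).  CONDITIONAL on the weight data and (R1). -/
theorem d1Tel_JsRowD1Pin_of_stepRecursion (hLc : Odd Lc) {N : ℕ} (hN : 2 ≤ N) {w : ℕ → EKer 4}
    (hwC : ∀ j, 1 ≤ j → ∀ κ l : Fin 4, ConstReproSum Lc (w j κ l) (if κ = l then (((Lc : ℝ) ^ (4 + 1))⁻¹) else 0))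
    (hwL : ∀ j, 1 ≤ j → ∀ κ l : Fin 4, ∃ C : Fin 4 → ℝ, LinReproSum Lc (w j κ l) C)
    (hwA : ∀ j, 1 ≤ j → ∀ κ l : Fin 4, AbsMoment₂ (w j κ l))
    (hrec : StepRecursion Lc (TbalOf Lc (JsRowD1Pin hLc N)) (TshotOf Lc (JcPin hLc N)) w) :
    D1Tel Lc (JsRowD1Pin hLc N) (JcPin hLc N) :=
  d1Tel_of_stepRecursion_of_stepWard (JsRowD1Pin hLc N) (JcPin hLc N) (stepT0_JsRowD1Pin hLc hN) (stepT1_JsRowD1Pin hLc hN) hwC hwL hwA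
    (hbase_JcPin hLc N) hrec

/-- [folklore] **`D1Tel` FOR THE LITERAL OF RECORD ⟸ THE ONE-STEP RECURSION AT an4's CANONICAL WEIGHT `wStep Lc` — ONE HYPOTHESIS**:
`StepRecursion Lc (TbalOf Lc (JsRowD1Pin hLc N)) (TshotOf Lc (JcPin hLc N)) (wStep Lc)`, i.e. for every `j ≥ 1` and every coarse bond pair
`TshotOf … (j+1) a b z = Lc^8 · dressedEntry (wStep Lc j) (TshotOf … j) (Lc•z) a b + TbalOf … j a b z` (the first step at block `Lc^(j+1)` = the first
step at block `Lc^j` transported through the step-`j` response on both legs + step `j` at block `Lc`).  Every other binder of an4's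
`d1Tel_of_stepRecursion_wStep` is discharged by §1.  CONDITIONAL on (R1) exactly — LAYER 2 of node P6, NOT proved here. -/
theorem d1Tel_JsRowD1Pin_of_stepRecursion_wStep (hLc : Odd Lc) {N : ℕ} (hN : 2 ≤ N)
    (hrec : StepRecursion Lc (TbalOf Lc (JsRowD1Pin hLc N)) (TshotOf Lc (JcPin hLc N)) (wStep Lc)) :
    D1Tel Lc (JsRowD1Pin hLc N) (JcPin hLc N) :=
  d1Tel_of_stepRecursion_wStep (JsRowD1Pin hLc N) (JcPin hLc N) (stepT0_JsRowD1Pin hLc hN) (stepT1_JsRowD1Pin hLc hN)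
    (hbase_JcPin hLc N) hrec

/-- [folklore] **`D1Tel` FOR THE LITERAL OF RECORD ⟸ THE RECURSION AT `wStep Lc` MODULO A REMAINDER INVISIBLE AT THE SECOND-MOMENT-TENSOR LEVEL**
(an4's socket for P6c «LongitudinalCancellation», `d1Tel_of_stepRecursionUpTo_wStep`): remainders `R j` (`j ≥ 1`) with vanishing zeroth∕first
moments, `AbsMoment₂` and vanishing second-moment TENSOR, and `StepRecursionUpTo … (wStep Lc) R`.  CONDITIONAL on those. -/
theorem d1Tel_JsRowD1Pin_of_stepRecursionUpTo_wStep (hLc : Odd Lc) {N : ℕ} (hN : 2 ≤ N) {R : ℕ → EKer 4}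
    (hR0 : ∀ j, 1 ≤ j → ∀ c e : Fin 4, HasSum (R j c e) 0)
    (hR1 : ∀ j, 1 ≤ j → ∀ c e ρ : Fin 4, HasSum (fun t : Fin 4 → ℤ => t ρ • R j c e t) 0)
    (hRA : ∀ j, 1 ≤ j → ∀ c e : Fin 4, AbsMoment₂ (R j c e)) (hR2 : ∀ j, 1 ≤ j → m2Tensor (R j) = 0)
    (hrec : StepRecursionUpTo Lc (TbalOf Lc (JsRowD1Pin hLc N)) (TshotOf Lc (JcPin hLc N)) (wStep Lc) R) :
    D1Tel Lc (JsRowD1Pin hLc N) (JcPin hLc N) :=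
  d1Tel_of_stepRecursionUpTo_wStep (JsRowD1Pin hLc N) (JcPin hLc N) (stepT0_JsRowD1Pin hLc hN) (stepT1_JsRowD1Pin hLc hN) hR0 hR1 hRA hR2
    (hbase_JcPin hLc N) hrec

/-- [folklore] **`D1Tel` FOR THE LITERAL OF RECORD ⟸ THE TRANSPORT-FREE ONE-STEP IDENTITY OF SECOND-MOMENT TENSORS** (`j ≥ 1`):
`m2Tensor (TshotOf … (j+1)) = m2Tensor (TshotOf … j) + m2Tensor (TbalOf … j)`; the base identity at tensor level is §1's.  CONDITIONAL on that. -/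
theorem d1Tel_JsRowD1Pin_of_m2Step (hLc : Odd Lc) {N : ℕ} (hN : 2 ≤ N)
    (hstep : ∀ j : ℕ, 1 ≤ j → m2Tensor (TshotOf Lc (JcPin hLc N) (j + 1))
      = m2Tensor (TshotOf Lc (JcPin hLc N) j) + m2Tensor (TbalOf Lc (JsRowD1Pin hLc N) j)) :
    D1Tel Lc (JsRowD1Pin hLc N) (JcPin hLc N) :=
  d1Tel_of_m2Step (JsRowD1Pin hLc N) (JcPin hLc N) (stepT0_JsRowD1Pin hLc hN) (stepT1_JsRowD1Pin hLc hN)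
    (by rw [hbase_JcPin hLc N]) hstep

/-- [folklore] **`D1Tel` FOR THE LITERAL OF RECORD IS EXACTLY THE SECOND-MOMENT-TENSOR STEP IDENTITY** (`j ≥ 1`; the base holds by §1). -/
theorem d1Tel_JsRowD1Pin_iff_m2Step (hLc : Odd Lc) {N : ℕ} (hN : 2 ≤ N) :
    D1Tel Lc (JsRowD1Pin hLc N) (JcPin hLc N) ↔
      ∀ j : ℕ, 1 ≤ j → m2Tensor (TshotOf Lc (JcPin hLc N) (j + 1))
        = m2Tensor (TshotOf Lc (JcPin hLc N) j) + m2Tensor (TbalOf Lc (JsRowD1Pin hLc N) j) := by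
  rw [d1Tel_iff_m2Step (JsRowD1Pin hLc N) (JcPin hLc N) (stepT0_JsRowD1Pin hLc hN) (stepT1_JsRowD1Pin hLc hN)]
  exact ⟨fun h => h.2, fun h => ⟨by rw [hbase_JcPin hLc N], h⟩⟩

/-! ## §3 The read-out level — the level the wall consumes (RULINGS (R27)/(R28-1)) -/

/-- [folklore] **`D1Tel ⟹ D1Sum` FOR THE LITERAL OF RECORD, EVERY CHANNEL** (the β-lead's `d1Sum_of_d1Tel` with the capstone's hW ∧ hR). -/
theorem d1Sum_JsRowD1Pin_of_d1Tel (hLc : Odd Lc) {N : ℕ} (hN : 2 ≤ N) (htel : D1Tel Lc (JsRowD1Pin hLc N) (JcPin hLc N))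
    (μ ν : Fin 4) : D1Sum Lc (JsRowD1Pin hLc N) (JcPin hLc N) μ ν :=
  d1Sum_of_d1Tel (JsRowD1Pin hLc N) (JcPin hLc N) (symmetries_JsRowD1Pin hLc hN).1 (symmetries_JsRowD1Pin hLc hN).2 htel μ ν

/-- [folklore] **THE ONE-STEP IDENTITY AT THE READ-OUT LEVEL WITH THE FULL DEFECT — UNCONDITIONAL FOR THE LITERAL OF RECORD**: for every `j ≥ 1`
and every channel `(μ, ν)`, `secondMoment (TshotOf … (j+1)) μ ν = secondMoment (TshotOf … j) μ ν + secondMoment (TbalOf … j) μ ν +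
secondMoment (SD Lc (JsRowD1Pin hLc N) (JcPin hLc N) j) μ ν` (the transported term carries the second moment of the transported kernel
unchanged — `d = 4` marginality of an admissible dressing; the one-shot Ward data are §1's; (SDA) is automatic).  So ALL the content of the
telescoping binder sits in the `(μ, ν)` second moments of the explicit step defects. -/
theorem secondMoment_step_JcPin (hLc : Odd Lc) {N : ℕ} (hN : 2 ≤ N) (μ ν : Fin 4) :
    ∀ j : ℕ, 1 ≤ j → secondMoment (TshotOf Lc (JcPin hLc N) (j + 1)) μ ν
      = secondMoment (TshotOf Lc (JcPin hLc N) j) μ ν + secondMoment (TbalOf Lc (JsRowD1Pin hLc N) j) μ ν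
          + secondMoment (SD Lc (JsRowD1Pin hLc N) (JcPin hLc N) j) μ ν :=
  secondMoment_step_sd (JsRowD1Pin hLc N) (JcPin hLc N) μ ν (shotT0_JcPin hLc hN) (shotT1_JcPin hLc hN)
    (fun j _ c e => absMoment₂_sd (JsRowD1Pin hLc N) (JcPin hLc N) j c e)

/-- [folklore] **FOR THE LITERAL OF RECORD THE READ-OUT-LEVEL TELESCOPING BINDER IS THE SINGLE CLOSED CLAUSE (SDF)** (`Odd Lc`, `2 ≤ N` only):
`D1Sum Lc (JsRowD1Pin hLc N) (JcPin hLc N) μ ν ↔ SDInvisible Lc (JsRowD1Pin hLc N) (JcPin hLc N) μ ν`, i.e. `Σ_{j<m} β⁰_j = secondMoment (TshotOf … m) μ ν`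
for all `m ≥ 1` IFF `∀ j ≥ 1, secondMoment (SD Lc (JsRowD1Pin hLc N) (JcPin hLc N) j) μ ν = 0` — the β-lead's `d1Sum_iff_sdInvisible'` with (T0)/(T1) of
BOTH families and the base identity supplied by §1.  Neither side is proved here. -/
theorem d1Sum_JsRowD1Pin_iff_sdInvisible (hLc : Odd Lc) {N : ℕ} (hN : 2 ≤ N) (μ ν : Fin 4) :
    D1Sum Lc (JsRowD1Pin hLc N) (JcPin hLc N) μ ν ↔ SDInvisible Lc (JsRowD1Pin hLc N) (JcPin hLc N) μ ν :=
  d1Sum_iff_sdInvisible' (JsRowD1Pin hLc N) (JcPin hLc N) (stepT0_JsRowD1Pin hLc hN) (stepT1_JsRowD1Pin hLc hN)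
    (shotT0_JcPin hLc hN) (shotT1_JcPin hLc hN) (hbase_JcPin hLc N)

/-- [folklore] **(R1) AT `wStep Lc` ⟹ (SDF) IN EVERY CHANNEL** for the literal of record: the one-step recursion makes the full step defect vanish
identically (an4's `stepRecursion_iff_stepDefect_eq_zero`), hence its second moments.  CONDITIONAL on (R1). -/
theorem sdInvisible_JsRowD1Pin_of_stepRecursion_wStep (hLc : Odd Lc) (N : ℕ)
    (hrec : StepRecursion Lc (TbalOf Lc (JsRowD1Pin hLc N)) (TshotOf Lc (JcPin hLc N)) (wStep Lc)) (μ ν : Fin 4) :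
    SDInvisible Lc (JsRowD1Pin hLc N) (JcPin hLc N) μ ν := by
  intro j hj
  have h0 : SD Lc (JsRowD1Pin hLc N) (JcPin hLc N) j = 0 := by
    rw [sd_eq_stepDefect]
    exact (stepRecursion_iff_stepDefect_eq_zero.1 hrec) j hj
  rw [h0]
  unfold B12Beta.secondMoment
  simp

/-! ## §4 The row END re-cut at the read-out level -/

/-- [folklore] **BINDER ROW D1 FOR THE LITERAL OF RECORD, RE-CUT: `D1Drift Lc (JsRowD1Pin hLc N) Nc μ ν` ⟸ (SDF) ∧ `D1Rep`** (+ the route theorem's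
printed B5 facts `Prop12Printed`∕`Kernel126_127Printed` BY NAME, the window data, `μ ≠ ν`, `Nc ≠ 0`, `2 ≤ Lc`, `2 ≤ N`): the β-lead's
`d1Drift_of_sdInvisible_D1Rep` with (T0)/(T1) of both families and the base identity supplied by §1.  NO Ward∕reflection binder, NO `D1Tel`, NO transport
family, NO remainder family is left in the row's statement: what remains is (SDF) for the literal (LAYER 2 of P6 + P6c, NOT proved here) and `D1Rep`
(EXIT-A ⇐ G-an2-4).  CONDITIONAL on exactly those; `Nc` not pinned to `N` ((P6)).  Binders 2∕4; NOT D1, NOT `BetaPertH`, NOT continuum, NOT Clay. -/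
theorem d1Drift_JsRowD1Pin_of_sdInvisible_D1Rep (hLc : Odd Lc) (hL2 : 2 ≤ Lc) {N : ℕ} (hN : 2 ≤ N)
    (a : ℝ) (ha : 0 < a)
    (h12 : B5.Prop12Printed (fam (fun i : ℕ+ × ℕ => ((i.1 : ℕ+) : ℕ)) (fun i => i.1.pos) MvE a ha))
    (h126 : B5.Kernel126_127Printed (kfam (fun i : ℕ+ × ℕ => ((i.1 : ℕ+) : ℕ)) MvE))
    {L : Type*} {SL : Finset L} (hSL : SL.Nonempty) (k : L → Fin 4) {μ ν : Fin 4} (hμν : μ ≠ ν) {Nc : ℝ} (hNc : Nc ≠ 0)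
    (hSF : SDInvisible Lc (JsRowD1Pin hLc N) (JcPin hLc N) μ ν)
    {cc : ℝ} {M : ℕ → ℕ} (hc : 1 ≤ cc) (hMw : ∀ L : ℕ, 2 ≤ L → 1 ≤ M L ∧ (L : ℝ) ≤ cc * M L) (hML : ∀ L : ℕ, 2 ≤ L → M L ≤ L)
    (hrep : D1Rep Lc (JcPin hLc N) Nc μ ν a SL k) :
    D1Drift Lc (JsRowD1Pin hLc N) Nc μ ν :=
  d1Drift_of_sdInvisible_D1Rep a ha h12 h126 hSL k hμν hNc hL2 (JsRowD1Pin hLc N) (JcPin hLc N) (stepT0_JsRowD1Pin hLc hN)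
    (stepT1_JsRowD1Pin hLc hN) (shotT0_JcPin hLc hN) (shotT1_JcPin hLc hN) (hbase_JcPin hLc N) hSF hc hMw hML hrep

/-- [folklore] **THE ROW END FROM `D1Sum` ∧ `D1Rep`** (read-out-level telescoping as such; NO letter, NO `D1Tel`): the β-lead's `d1Drift_of_d1Sum_D1Rep`
at the literal of record.  CONDITIONAL on `D1Sum` and `D1Rep`. -/
theorem d1Drift_JsRowD1Pin_of_d1Sum_D1Rep (hLc : Odd Lc) (hL2 : 2 ≤ Lc) (N : ℕ)
    (a : ℝ) (ha : 0 < a)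
    (h12 : B5.Prop12Printed (fam (fun i : ℕ+ × ℕ => ((i.1 : ℕ+) : ℕ)) (fun i => i.1.pos) MvE a ha))
    (h126 : B5.Kernel126_127Printed (kfam (fun i : ℕ+ × ℕ => ((i.1 : ℕ+) : ℕ)) MvE))
    {L : Type*} {SL : Finset L} (hSL : SL.Nonempty) (k : L → Fin 4) {μ ν : Fin 4} (hμν : μ ≠ ν) {Nc : ℝ} (hNc : Nc ≠ 0)
    (hsum : D1Sum Lc (JsRowD1Pin hLc N) (JcPin hLc N) μ ν)
    {cc : ℝ} {M : ℕ → ℕ} (hc : 1 ≤ cc) (hMw : ∀ L : ℕ, 2 ≤ L → 1 ≤ M L ∧ (L : ℝ) ≤ cc * M L) (hML : ∀ L : ℕ, 2 ≤ L → M L ≤ L)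
    (hrep : D1Rep Lc (JcPin hLc N) Nc μ ν a SL k) :
    D1Drift Lc (JsRowD1Pin hLc N) Nc μ ν :=
  d1Drift_of_d1Sum_D1Rep a ha h12 h126 hSL k hμν hNc hL2 (JsRowD1Pin hLc N) (JcPin hLc N) hsum hc hMw hML hrep

/-- [folklore] **THE ROW END FROM (R1) AT `wStep Lc` ∧ `D1Rep`**: `D1Drift Lc (JsRowD1Pin hLc N) Nc μ ν` ⟸
`StepRecursion Lc (TbalOf Lc (JsRowD1Pin hLc N)) (TshotOf Lc (JcPin hLc N)) (wStep Lc)` ∧ `D1Rep Lc (JcPin hLc N) Nc μ ν a SL k` (+ printed B5 facts BY NAME,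
window, `μ ≠ ν`, `Nc ≠ 0`, `2 ≤ Lc`, `2 ≤ N`).  CONDITIONAL on (R1) (LAYER 2 of P6) and `D1Rep` (EXIT-A); binders 2∕4; NOT D1, NOT `BetaPertH`, NOT
continuum, NOT Clay. -/
theorem d1Drift_JsRowD1Pin_of_stepRecursion_D1Rep (hLc : Odd Lc) (hL2 : 2 ≤ Lc) {N : ℕ} (hN : 2 ≤ N)
    (a : ℝ) (ha : 0 < a)
    (h12 : B5.Prop12Printed (fam (fun i : ℕ+ × ℕ => ((i.1 : ℕ+) : ℕ)) (fun i => i.1.pos) MvE a ha))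
    (h126 : B5.Kernel126_127Printed (kfam (fun i : ℕ+ × ℕ => ((i.1 : ℕ+) : ℕ)) MvE))
    {L : Type*} {SL : Finset L} (hSL : SL.Nonempty) (k : L → Fin 4) {μ ν : Fin 4} (hμν : μ ≠ ν) {Nc : ℝ} (hNc : Nc ≠ 0)
    (hrec : StepRecursion Lc (TbalOf Lc (JsRowD1Pin hLc N)) (TshotOf Lc (JcPin hLc N)) (wStep Lc))
    {cc : ℝ} {M : ℕ → ℕ} (hc : 1 ≤ cc) (hMw : ∀ L : ℕ, 2 ≤ L → 1 ≤ M L ∧ (L : ℝ) ≤ cc * M L) (hML : ∀ L : ℕ, 2 ≤ L → M L ≤ L)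
    (hrep : D1Rep Lc (JcPin hLc N) Nc μ ν a SL k) :
    D1Drift Lc (JsRowD1Pin hLc N) Nc μ ν :=
  d1Drift_JsRowD1Pin_of_sdInvisible_D1Rep hLc hL2 hN a ha h12 h126 hSL k hμν hNc
    (sdInvisible_JsRowD1Pin_of_stepRecursion_wStep hLc N hrec μ ν) hc hMw hML hrep

end

end Summit.QuantumFields.BalabanUV.Beta.RowD1Telescoping
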